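import Literature.NumberTheory.Automorphic.ACCAutomorphyLiftingCrystalline
import Literature.NumberTheory.Automorphic.Qian2022PotentialAutomorphy
import Literature.NumberTheory.Automorphic.EssConjSelfDual
import Literature.NumberTheory.GaloisRepresentations.ExtendedAdequateSubgroup
import Literature.NumberTheory.GaloisRepresentations.AbsGaloisOuterConj
import HarnessLib

/-!
# Thorne 2017 (Math. Z. 285), Thm. 5.1: automorphy lifting for `p`-adic Galois representations of
# unitary type over an imaginary CM field, ANY prime `p` — minimal, crystalline-ordinary case

Topic `NumberTheory/Automorphic`, pattern of `ACCAutomorphyLiftingCrystalline.lean`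
(`ACCGHLNSTT2023.automorphyLifting_crystalline_weightZero`) and `Qian2022PotentialAutomorphy.lean`
(`Qian2022.potentialAutomorphy_ordinary`, `Qian2022.IsAutomorphic`).  Vocabulary: `FramedGaloisRep`,
`IsUnramifiedAt`, `toLocal`, `IsResidualRepOf`, `padicAlgClResidueField` (`ResidualGaloisRep`),
`absGaloisGroupAdjoinRootsOfUnity` (`DecomposedGeneric`), `Subgroup.IsThorne2017Adequate`
(`ExtendedAdequateSubgroup`, Thorne's Def. 2.20 — item `defn-ExtendedAdequate`), `FramedGaloisRep.outerConj`,
`absGaloisQuot` (`AbsGaloisOuterConj`: the conjugate representation `ρ^c`), `GaloisRep.cyclotomicCharacter`,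
`FramedGaloisRep.IsOrdinaryOfLabelledWeightAt` (`OrdinaryRegular`, relative to local Artin data),
`PstWeilDeligneData.IsCrystallineFramed` with the pinned datum `fontainePstAdicCompletion` (`FontaineDpst`),
`CuspidalAutomorphicRepData`, `IsRegularAlgebraic`, `AutomorphicRepData.IsEssConjSelfDual` (`EssConjSelfDual`),
`HarrisLanTaylorThorne2016.IsCompatible` (`ReciprocityGLn`), `Qian2022.IsAutomorphic`.
Requested by the line `thorne-minimal-lift` of crux `stmt-Langlands-13757` (`stub_thorneLift`,
`stub_pointAutomorphic`; `n = p = 3`, `F = ℚ(ζ₃, √d)`), `wi-37169`.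

J. A. Thorne, *A 2-adic automorphy lifting theorem for unitary groups over CM fields*, Math. Z. 285
(2017) 1–38, doi:10.1007/s00209-016-1681-2 (held text `paper:doi-10-1007-s00209-016-1681-2`, read
2026-08-17), **Theorem 5.1** (= Thm. 1.1; p. 38 and p. 2), as printed:

> Let `n ≥ 2`. Let `F` be an imaginary CM number field with totally real subfield `F⁺`. Fix a prime
> `p` and an isomorphism `ι : ℚ̄_p ≅ ℂ`, and consider a continuous representation
> `ρ : G_F → GL_n(ℚ̄_p)`. Suppose that `ρ` satisfies the following conditions:
> (i) There is an isomorphism `ρ^c ≅ ρ^∨ ε^{1−n}`.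
> (ii) The group `ρ̄(G_{F(ζ_p)}) ⊂ GL_n(𝔽̄_p)` is adequate, in the sense of Definition 2.20.
> (iii) The representation `ρ` is almost everywhere unramified.
> (iv) There exists a RACSDC automorphic representation `π` of `GL_n(𝔸_F)` such that:
>   (a) There is an isomorphism `\overline{r_ι(π)} ≅ ρ̄`.
>   (b) For each finite place `v` of `F`, we have `r_ι(π)|_{G_{F_v}} ∼ ρ|_{G_{F_v}}` (this condition is
>       automatic if `π_v` and `ρ|_{G_{F_v}}` are both unramified). In particular, if `v | p`, then
>       `ρ|_{G_{F_v}}` and `r_ι(π)|_{G_{F_v}}` are potentially crystalline.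
> (v) If `p = 2` and `n` is even, then there exists a place `v | ∞` of `F⁺` at which the pair
>     `(ρ̄, ε^{1−n} δ^n_{F/F⁺})` is strongly residually odd, in the sense of Definition 3.3.
> Then `ρ` is automorphic: there exists a RACSDC automorphic representation `Π` of `GL_n(𝔸_F)` such
> that `ρ ≅ r_ι(Π)`.

("RACSDC", §3 p. 26: "`π` is regular algebraic; `π` is conjugate self-dual, i.e. `π^c ≅ π^∨`,
`c ∈ Gal(F/F⁺)` the non-trivial element; `π` is cuspidal"; `r_ι(π)` the continuous semi-simple
representation attached to `π` and `ι`, loc. cit.; "`∼`" = "connects", Def. 3.6 (p. 29), at `v ∣ p`: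
"there exists a finite extension `K'/K` and `λ_v` such that each of `ρ₁|_{G_{K'}}` and `ρ₂|_{G_{K'}}`
is crystalline of Hodge–Tate type `λ_v`, and `ρ₁, ρ₂` define points on a common irreducible component
of `Spec(R^{λ_v, K'-cris} ⊗ ℚ̄_p)`", the notion of Barnet-Lamb–Gee–Geraghty–Taylor, §1.4.)
"We state the theorem with no restriction on `p` … even in the case where `p` is odd, we are able to
make a slight improvement on existing results" (p. 2): no hypothesis `ζ_p ∉ F`, and `p ∣ n` is allowed
by the extended notion of adequacy (Def. 2.20, Prop. 2.21).

## What is vendored: the MINIMAL, CRYSTALLINE-ORDINARY case, with `(v)` vacuous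

NAMED FACT (D-0014) `Thorne2017.automorphyLifting_unitary_ordinaryMinimal 𝓐`, Theorem 5.1 with its
hypotheses SPECIALISED as follows (each specialisation is printed-sufficient, never weaker):

* `¬ (p = 2 ∧ n even)`, so that (v) is empty;
* (iv)(b) at `v ∤ p` in its "automatic" case: `π_v`, `ρ|_{G_{F_v}}` and `r_ι(π)|_{G_{F_v}}` unramified;
* (iv)(b) at `v ∣ p` in the crystalline-ordinary case: `ρ|_{G_{F_v}}` and `r_ι(π)|_{G_{F_v}}` are both
  crystalline (relative to the pinned Fontaine datum of `F_v`) and both ordinary of ONE AND THE SAME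
  labelled weight `wt` (relative to the local Artin datum `𝓐 F v`).  This implies `∼`: by
  [BLGGT] §1.4 (arXiv pp. 14–15), Lemma 1.4.3 (1) ("If `ρ` has a `G_K`-invariant filtration with one
  dimensional graded pieces, in particular if it is ordinary, then `ρ` is potentially diagonalizable"),
  after a finite extension `K'` trivialising `ρ̄` each of the two is `∼` to a sum of crystalline
  characters with the Hodge–Tate numbers dictated by `wt`, termwise equal up to unramified characters
  with trivial reduction, hence `∼` to each other by the bullets of §1.4 (unramified twists, direct sums;
  "'Connects' is an equivalence relation"), which is Thorne's Def. 3.6 (ii) verbatim.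

Clause renderings (as in the two pattern files): `F` imaginary CM = Mathlib `NumberField.IsCMField F`
(`F⁺ = maximalRealSubfield F`, `c = IsCMField.complexConj F`); (i) in TRACE FORM along a lift
`c̃ ∈ Γ_{F⁺}` of `c` (`absGaloisQuot F⁺ F c̃ = c`): `tr ρ(θ_{c̃} σ) = ε(σ)^{1−n} tr ρ(σ⁻¹)` for all
`σ ∈ Γ_F` (`FramedGaloisRep.outerConj`; equivalent to `ρ^c ≅ ρ^∨ ε^{1−n}` for the absolutely irreducible
`ρ` at hand — adequacy of `ρ̄(G_{F(ζ_p)})` makes `ρ̄`, hence `ρ`, absolutely irreducible — by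
Brauer–Nesbitt, and independent of the lift); (ii) for SOME residual representation `τ = ρ̄`
(`IsResidualRepOf`), `Subgroup.IsThorne2017Adequate (τ(Γ_{F(ζ_p)}))`; (iii) `∀ᶠ v, ρ` unramified;
(iv) `π : CuspidalAutomorphicRepData n F hcpt` regular algebraic and conjugate self-dual
(`IsEssConjSelfDual π 1`), and — the tree having `r_ι(π)` only through its characterising property —
a framed `r` with `HarrisLanTaylorThorne2016.IsCompatible π ι r` (hence `r^{ss} ≅ r_ι(π)`; here
`r̄ = τ` is absolutely irreducible, so `r ≅ r_ι(π)`) whose residual representation is the same `τ`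
((iv)(a)); conclusion `Qian2022.IsAutomorphic ι ρ` ("`ρ ≅ r_ι(Π)` for a regular algebraic cuspidal `Π`",
weaker than RACSDC `Π`).  Local Artin data `𝓐` are a parameter of the fact, as in
`Qian2022.potentialAutomorphy_ordinary`.
-- TODO(general form): (iv)(b) as "connects" (Def. 3.6) at all finite places; (v) for `p = 2`, `n` even.

## References

* [Thorne2017TwoAdic] J. A. Thorne, Math. Z. 285 (2017) 1–38, Thm. 5.1 (= Thm. 1.1), Def. 2.20,
  Prop. 2.21, §3 (RACSDC, `r_ι(π)`), Def. 3.3, Def. 3.6, Thm. 4.2, Cor. 4.3.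
* [BarnetlambEtAl2014] T. Barnet-Lamb, T. Gee, D. Geraghty, R. Taylor, *Potential automorphy and
  change of weight*, Ann. of Math. 179 (2014), §1.4 (arXiv:1010.2561, pp. 14–15), Lemma 1.4.3 (1).
* [HarrisLanTaylorThorneRMS2016] M. Harris, K.-W. Lan, R. Taylor, J. Thorne, Res. Math. Sci. 3:37
  (2016), Thm. A.
* [Qian2022] L. Qian, Invent. Math. 231 (2023), Def. 1.2–1.3.
-/

noncomputable section

open scoped MatrixGroups NumberField Classical
open NumberField IsDedekindDomain Field Filter
open Literature.NumberTheory.GaloisRepresentations Literature.NumberTheory.PAdicHodge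

namespace Literature.NumberTheory.Automorphic

namespace Thorne2017

/-- **Thorne 2017, Thm. 5.1 — minimal, crystalline-ordinary case, `(p, n) ≠ (2, even)`**, NAMED FACT.
For local Artin data `𝓐`: for every imaginary CM number field `F` (`F⁺` its maximal real subfield,
`c` complex conjugation), `n ≥ 2`, prime `p` with `¬(p = 2 ∧ n even)`, `ι : ℚ̄_p ≅ ℂ`, continuous
`ρ : Γ_F → GL_n(ℚ̄_p)`, and a lift `c̃ ∈ Γ_{F⁺}` of `c`, IF
(i) `ρ^c ≅ ρ^∨ ε^{1−n}` (trace form: `tr ρ(θ_{c̃} σ) = ε(σ)^{1−n} · tr ρ(σ⁻¹)` for all `σ ∈ Γ_F`);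
(ii) some residual representation `τ = ρ̄ : Γ_F → GL_n(𝔽̄_p)` of `ρ` has `τ(Γ_{F(ζ_p)})` adequate in the
sense of Thorne's Def. 2.20 (`Subgroup.IsThorne2017Adequate`; `p ∣ n` and `ζ_p ∈ F` allowed);
(iii) `ρ` is unramified at all but finitely many places;
(iv) there are a cuspidal automorphic representation `π` of `GL_n(𝔸_F)` which is regular algebraic and
conjugate self-dual (RACSDC) and a framed `r : Γ_F → GL_n(ℚ̄_p)` with the characterising property of
`r_ι(π)` (`HarrisLanTaylorThorne2016.IsCompatible`) and residual representation `τ` ((a): `r̄_ι(π) ≅ ρ̄`),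
such that (b, minimal case) at every finite `v ∤ p` the three of `π_v`, `ρ|_{Γ_{F_v}}`, `r|_{Γ_{F_v}}` are
unramified, and at every `v ∣ p` both `ρ|_{Γ_{F_v}}` and `r|_{Γ_{F_v}}` are crystalline (pinned Fontaine
datum) and ordinary of one and the same labelled weight (relative to `𝓐 F v`) — which gives
`r_ι(π)|_{G_{F_v}} ∼ ρ|_{G_{F_v}}` by [BLGGT] §1.4, Lemma 1.4.3 (1) —
THEN `ρ` is automorphic (`Qian2022.IsAutomorphic ι ρ`: `ρ ≅ r_ι(Π)` for a regular algebraic cuspidal `Π`).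
Printed theorem quoted in the module docstring; hypothesis (v) is vacuous here.
[cite: Thorne2017TwoAdic, Thm. 5.1 (= Thm. 1.1) with Def. 2.20, §3 (p. 26) and Def. 3.6]
[cite: BarnetlambEtAl2014, §1.4, Lemma 1.4.3 (1)] -/
def automorphyLifting_unitary_ordinaryMinimal
    (𝓐 : ∀ (K : Type) [Field K] [NumberField K] (v : HeightOneSpectrum (𝓞 K)),
      LocalArtinData (v.adicCompletion K)) : Prop :=
  ∀ (F : Type) [Field F] [NumberField F] [IsCMField F],
    ∀ (n : ℕ), 2 ≤ n →
    ∀ (p : ℕ) [Fact p.Prime], ¬ (p = 2 ∧ Even n) →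
    ∀ (hcpt : isCompact_glFiniteIntegralLevel n F) (ι : PadicAlgCl p ≃+* ℂ)
      (ρ : FramedGaloisRep F (PadicAlgCl p) n)
      (τ : absoluteGaloisGroup F →* GL (Fin n) (padicAlgClResidueField p))
      (π : CuspidalAutomorphicRepData n F hcpt) (r : FramedGaloisRep F (PadicAlgCl p) n)
      (c : absoluteGaloisGroup (maximalRealSubfield F)),
      -- `c` induces the complex conjugation of the CM field `F`
      absGaloisQuot (maximalRealSubfield F) F c = IsCMField.complexConj F →
      -- (i) `ρ^c ≅ ρ^∨ ⊗ ε^{1-n}`, trace form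
      (∀ σ : absoluteGaloisGroup F,
        ((FramedGaloisRep.outerConj c ρ) σ).val.trace =
          ((Units.map (algebraMap ℤ_[p] (PadicAlgCl p)).toMonoidHom
              (GaloisRep.cyclotomicCharacter F p σ) ^ (1 - (n : ℤ)) : (PadicAlgCl p)ˣ) : PadicAlgCl p) *
            (ρ σ⁻¹).val.trace) →
      -- (ii) `τ = ρ̄` and `ρ̄(Γ_{F(ζ_p)})` adequate in the sense of Def. 2.20
      ρ.IsResidualRepOf (RingHom.id _) τ →
      Subgroup.IsThorne2017Adequate ((absGaloisGroupAdjoinRootsOfUnity F p).map τ) →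
      -- (iii) almost everywhere unramified
      (∀ᶠ v : HeightOneSpectrum (𝓞 F) in cofinite, ρ.IsUnramifiedAt v) →
      -- (iv) `π` RACSDC; `r` has the characterising property of `r_ι(π)` and residual rep `τ` ((a))
      π.1.IsRegularAlgebraic → π.1.IsEssConjSelfDual 1 →
      HarrisLanTaylorThorne2016.IsCompatible π.1 ι r → r.IsResidualRepOf (RingHom.id _) τ →
      -- (iv)(b), `v ∤ p`: the automatic (unramified) case
      (∀ v : HeightOneSpectrum (𝓞 F), ((p : ℕ) : 𝓞 F) ∉ v.asIdeal →
        π.1.IsUnramifiedAt v ∧ ρ.IsUnramifiedAt v ∧ r.IsUnramifiedAt v) →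
      -- (iv)(b), `v ∣ p`: both crystalline and ordinary of a common labelled weight
      (∀ (v : HeightOneSpectrum (𝓞 F)) (hv : ((p : ℕ) : 𝓞 F) ∈ v.asIdeal),
        (fontainePstAdicCompletion v p hv).IsCrystallineFramed (ρ.toLocal v) ∧
        (fontainePstAdicCompletion v p hv).IsCrystallineFramed (r.toLocal v) ∧
        ∃ wt : LabelledWeight (v.adicCompletion F) (PadicAlgCl p) n,
          ρ.IsOrdinaryOfLabelledWeightAt v (𝓐 F v) wt ∧ r.IsOrdinaryOfLabelledWeightAt v (𝓐 F v) wt) →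
      -- conclusion: `ρ` is automorphic
      Qian2022.IsAutomorphic ι ρ

end Thorne2017

end Literature.NumberTheory.Automorphic

end
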